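import Mathlib.Analysis.SpecialFunctions.Trigonometric.Basic
import Literature.MathematicalPhysics.QuantumLattice.HubbardModel
import HarnessLib

/-!
# Lieb's flux-phase theorem for the half-filled Hubbard torus (Lieb 1994)

E. H. Lieb, *Flux phase of the half-filled band*, Phys. Rev. Lett. **73** (1994) 2158–2161
(= arXiv:cond-mat/9410025) [Lieb1994]. Setting (loc. cit. pp. 1–3): a bipartite graph `Λ` wrapped
on a cylinder or torus, hopping amplitudes `t_{xy} = |t_{xy}| e^{iφ(x,y)}` with PRESCRIBED moduli
and ARBITRARY phases (possibly different for the two spin values, `t^↑`, `t^↓`), and the Hamiltonian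

  `H = K + W⁰`,  `K = -∑_σ ∑_{x,y} t^σ_{xy} c†_{xσ} c_{yσ}`,
  `W⁰ = ∑_x U_x (n_{x↑} - ½)(n_{x↓} - ½)`  (any sign of `U_x`; "half-filled band" through the
  built-in chemical potential),

(the paper also allows longer-range density–density and spin–spin terms `W^d`, `W^s`, dropped
here — "nothing essential will be lost by setting `W^d = W^s = 0`", p. 2). The flux through a
circuit is the sum of the phases along it (mod `2π`).

> **THEOREM (Flux `π` is optimal)** (p. 4). *Assume the `|t^{↑,↓}_{xy}|` are reflection invariant
> w.r.t. `P`. Assume also that `Θ(W^α_L) = W^α_R` and `W^α_int` is reflection positive,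
> `α = 0, d, s`. Then `Z` is maximized by putting flux `π` in each square face of `Λ` that
> intersects `P`.*  Here `Z = Tr exp[-βH]`, `β ≥ 0` ("for all `β ≤ ∞`", p. 2; `β = ∞` is the
> ground-state energy over all of Fock space, Remark (iii)); and (p. 2) *"If the `|t_{xy}|`'s are
> reflection symmetric w.r.t. every choice of cutting lines … then flux `π` will be optimal in
> every square of `Λ`"*, *"The usual square lattice with periodic boundary conditions is
> included."*

## What is vendored

The NAMED FACT `Lieb1994_fluxPi_torus` is the theorem in the case the paper singles out: the
square torus `(ℤ/Lℤ)²`, `L` even, nearest-neighbour hopping of constant modulus `t ≥ 0` for both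
spins (so `|T|` is reflection symmetric with respect to EVERY family of bond-bisecting lines, and
so is the constant `U`), arbitrary bond- and spin-dependent phases: for every `β > 0` and every
phase configuration there is a phase configuration with flux `π` (mod `2π`) through every
elementary plaquette whose partition function is at least as large; and likewise (`β = ∞`) one
whose ground-state energy (over all of Fock space) is at least as small. This "for every
configuration there is a `π`-flux configuration at least as good" form is exactly "the maximum is
attained in the flux-`π` class" (the phases range over a compact torus and `Z` is continuous), and
it does not presuppose that different `π`-flux configurations (which may differ by the fluxes
through the two non-contractible cycles) have equal `Z`.

Definitions (thin, over the tree's Jordan–Wigner fermions of `HubbardWave0` / `HubbardModel`):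
* `peierlsHubbard G T U` — `H = K + W⁰` on a finite graph with complex, spin-dependent hopping
  amplitudes `T σ x y = t^σ_{xy}` (Lieb's eq. (1)–(2) with `W^d = W^s = 0`);
* `torusStep L i x` — the neighbour `x + e_i` on the fermionic torus `FermionTorus 2 L`;
* `phaseHopping t θ` — amplitudes `t e^{iθ_σ(x,y)}`; `plaquetteFlux θ σ x` — the flux
  `θ(x, x+e₀) + θ(x+e₀, x+e₀+e₁) + θ(x+e₀+e₁, x+e₁) + θ(x+e₁, x)` of spin `σ` through the plaquette
  with lower-left corner `x`; `HasPiFlux θ` — every plaquette flux is `π` mod `2π`, for both spins.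

## Deliberately NOT vendored
* the **Lemma (reflection positivity)**, eqs. (6)–(7) (`Z(H_L,H_R)² ≤ Z(H_L,Θ H_L) Z(Θ H_R,H_R)`
  and the Gaussian-domination form) — it needs the antiunitary fermionic reflection `Θ` and the
  left/right CAR subalgebras, a separate definition request (`IsFermionRP`, route ShibaRP);
* the general cylinder / non-uniform `|t_{xy}|` / `W^d`, `W^s` version, `D ≥ 3`, and Remark (iii)
  (`N = |Λ|` in a ground state);
* the corollary drawn on idea cards ("`H_R = Θ(H_L)` forces flux `π` in the cut squares, so the
  zero-flux real-hopping torus is not `Θ`-symmetric") — a consequence of eq. (4), not a printed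
  statement.

Secondary source for the theorem and an improved proof: N. Macris, B. Nachtergaele, *On the flux
phase conjecture at half-filling: an improved proof*, J. Stat. Phys. 85 (1996) 745–761.

## Non-vacuity of the `π`-flux class (why `L` is even)
On `(ℤ/Lℤ)²` with `L` even, `L ≥ 3`, an antisymmetric `π`-flux configuration exists, e.g.
`θ σ x y = g x y - g y x` with `g x y = π·x₁` if `y = x + e₀` and `0` otherwise (`x₁ ∈ {0,…,L-1}`
the row index): around the plaquette at `x` only the two horizontal bonds contribute, giving
`π x₁ - π·((x₁ + 1) mod L)`, which is `-π` for `x₁ < L - 1` and `π(L-1) ≡ π (mod 2π)` in the last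
row because `L` is even (for odd `L` the total flux `L²·π ≢ 0` would contradict the vanishing of
the sum of all plaquette fluxes on a torus, so no `π`-flux configuration exists — hence `Even L`).
-/

noncomputable section

namespace Literature.MathematicalPhysics.QuantumLattice

open Matrix Finset HubbardWave0
open scoped ComplexOrder

/-! ### The Peierls–Hubbard Hamiltonian with complex, spin-dependent hopping -/

section Peierls

variable {Λ : Type*} [LinearOrder Λ] [Fintype Λ] (G : SimpleGraph Λ) [DecidableRel G.Adj]

/-- **Lieb's Hamiltonian `H = K + W⁰`** on a finite graph `G` [Lieb1994, eqs. (1)–(2) with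
`W^d = W^s = 0`]: `K = -∑_σ ∑_{x ~ y} T σ x y · c†_{xσ} c_{yσ}` with complex, spin-dependent
hopping amplitudes `T σ x y = t^σ_{xy}` (the sum runs over ordered adjacent pairs; `K` is
Hermitian when `T σ y x = conj (T σ x y)`), and the particle–hole symmetric on-site interaction
`W⁰ = U ∑_x (n_{x↑} - ½)(n_{x↓} - ½)` (constant `U` of either sign; the chemical potential of the
half-filled band is built in). Reuses `creation`/`annihilation`/`numberOp`/`orb` of `HubbardWave0`.
[cite: Lieb1994, eqs. (1)-(2)] -/
def peierlsHubbard (T : Fin 2 → Λ → Λ → ℂ) (U : ℝ) : Matrix (Finset (Orb Λ)) (Finset (Orb Λ)) ℂ :=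
  -(∑ x : Λ, ∑ y : Λ, ∑ σ : Fin 2,
      if G.Adj x y then T σ x y • (creation (orb x σ) * annihilation (orb y σ)) else 0) +
    (U : ℂ) • ∑ x : Λ, (numberOp x 0 - (1 / 2 : ℂ) • 1) * (numberOp x 1 - (1 / 2 : ℂ) • 1)

/-- Unfolding lemma for `peierlsHubbard`. [folklore] -/
theorem peierlsHubbard_def (T : Fin 2 → Λ → Λ → ℂ) (U : ℝ) :
    peierlsHubbard G T U =
      -(∑ x : Λ, ∑ y : Λ, ∑ σ : Fin 2,
          if G.Adj x y then T σ x y • (creation (orb x σ) * annihilation (orb y σ)) else 0) +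
        (U : ℂ) • ∑ x : Λ, (numberOp x 0 - (1 / 2 : ℂ) • 1) * (numberOp x 1 - (1 / 2 : ℂ) • 1) :=
  rfl

end Peierls

/-! ### The square torus: steps, phases, plaquette fluxes -/

section Torus

variable {L : ℕ} [NeZero L]

/-- The neighbour `x + e_i` of a site of the fermionic torus `FermionTorus 2 L = (ℤ/Lℤ)²`
(addition mod `L` in coordinate `i`, through `FermionTorus.equivTorusSite`). [folklore] -/
def torusStep (i : Fin 2) (x : FermionTorus 2 L) : FermionTorus 2 L :=
  FermionTorus.ofTorusSite (x.toTorusSite + Pi.single i 1)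

/-- Nearest-neighbour hopping amplitudes of constant modulus `t` and phases `θ`:
`t^σ_{xy} = t · e^{i θ σ x y}` [Lieb1994, p. 1: `t_{xy} = |t_{xy}| exp[iφ(x,y)]`].
[cite: Lieb1994, p. 1] -/
def phaseHopping (t : ℝ) (θ : Fin 2 → FermionTorus 2 L → FermionTorus 2 L → ℝ) :
    Fin 2 → FermionTorus 2 L → FermionTorus 2 L → ℂ :=
  fun σ x y => (t : ℂ) * Complex.exp (Complex.I * (θ σ x y : ℂ))

/-- The flux of spin `σ` through the elementary plaquette with lower-left corner `x` — the sum of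
the phases around the circuit `x → x+e₀ → x+e₀+e₁ → x+e₁ → x` [Lieb1994, p. 1: "`T` has flux `Φ`
through `Q` if `∏ t = |∏ t| e^{iΦ}`", i.e. `Φ = ∑ φ` mod `2π`]. [cite: Lieb1994, p. 1] -/
def plaquetteFlux (θ : Fin 2 → FermionTorus 2 L → FermionTorus 2 L → ℝ) (σ : Fin 2)
    (x : FermionTorus 2 L) : ℝ :=
  θ σ x (torusStep 0 x) + θ σ (torusStep 0 x) (torusStep 1 (torusStep 0 x)) +
    θ σ (torusStep 1 (torusStep 0 x)) (torusStep 1 x) + θ σ (torusStep 1 x) x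

/-- **Flux `π` in every plaquette** (for both spin values): every elementary plaquette flux is
`π` mod `2π` [Lieb1994, p. 1 and Theorem]. [cite: Lieb1994, Theorem (p. 4)] -/
def HasPiFlux (θ : Fin 2 → FermionTorus 2 L → FermionTorus 2 L → ℝ) : Prop :=
  ∀ σ x, ∃ k : ℤ, plaquetteFlux θ σ x = Real.pi + 2 * Real.pi * k

/-- Lieb's Hamiltonian on the square torus `(ℤ/Lℤ)²` with uniform hopping modulus `t`, phases
`θ` and coupling `U`: `peierlsHubbard (fermionTorusGraph 2 L) (phaseHopping t θ) U`.
[cite: Lieb1994, eqs. (1)-(2)] -/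
def peierlsHubbardTorus (L : ℕ) [NeZero L] (t U : ℝ)
    (θ : Fin 2 → FermionTorus 2 L → FermionTorus 2 L → ℝ) :
    Matrix (Finset (Orb (FermionTorus 2 L))) (Finset (Orb (FermionTorus 2 L))) ℂ :=
  peierlsHubbard (fermionTorusGraph 2 L) (phaseHopping t θ) U

end Torus

/-! ### The theorem -/

/-- **Lieb's flux-phase theorem on the even square torus** [Lieb1994, Theorem "Flux `π` is
optimal" (p. 4) with p. 2: "If the `|t_{xy}|`'s are reflection symmetric w.r.t. every choice of
cutting lines … then flux `π` will be optimal in every square of `Λ`"; "The usual square lattice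
with periodic boundary conditions is included"], as a named fact, in the uniform-modulus case
(constant `|t^↑| = |t^↓| = t ≥ 0` on all nearest-neighbour bonds of `(ℤ/Lℤ)²`, `L` even, `L ≥ 4`;
constant `U` of any sign; `H = K + W⁰` at half filling, `peierlsHubbardTorus`): among all phase
configurations `θ` (bond- and spin-dependent, antisymmetric under bond reversal, so that `H` is
Hermitian) the partition function `Z_β = Tr e^{-βH}` (`Matrix.partitionFn`, real for Hermitian
`H`) is maximised in the class of configurations with flux `π` through every plaquette, for every
`0 < β < ∞`; and (`β = ∞`) the ground-state energy over all of Fock space (`Matrix.groundEnergy`)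
is minimised in that class. Stated as: for every admissible `θ` there is an admissible `π`-flux
`θ'` doing at least as well. The RP Lemma (eqs. (6)–(7)) behind it is not vendored (see the module
docstring). [cite: Lieb1994, Theorem (p. 4) and p. 2] -/
def Lieb1994_fluxPi_torus : Prop :=
  ∀ (L : ℕ) [NeZero L], Even L → 4 ≤ L → ∀ (t U : ℝ), 0 ≤ t →
    (∀ β : ℝ, 0 < β →
      ∀ θ : Fin 2 → FermionTorus 2 L → FermionTorus 2 L → ℝ, (∀ σ x y, θ σ y x = -θ σ x y) →
        ∃ θ' : Fin 2 → FermionTorus 2 L → FermionTorus 2 L → ℝ, (∀ σ x y, θ' σ y x = -θ' σ x y) ∧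
          HasPiFlux θ' ∧
          ((peierlsHubbardTorus L t U θ).partitionFn β).re ≤
            ((peierlsHubbardTorus L t U θ').partitionFn β).re) ∧
    (∀ θ : Fin 2 → FermionTorus 2 L → FermionTorus 2 L → ℝ, (∀ σ x y, θ σ y x = -θ σ x y) →
      ∃ θ' : Fin 2 → FermionTorus 2 L → FermionTorus 2 L → ℝ, (∀ σ x y, θ' σ y x = -θ' σ x y) ∧
        HasPiFlux θ' ∧
        (peierlsHubbardTorus L t U θ').groundEnergy ≤ (peierlsHubbardTorus L t U θ).groundEnergy)

end Literature.MathematicalPhysics.QuantumLattice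

end
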